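import Mathlib
import Summits.AtomisticToContinuum.FouriersLaw.Theorems.EmbeddedDrudeMourreDrudeDissolutionCutoffProducts
import Summits.AtomisticToContinuum.FouriersLaw.Theorems.EmbeddedDrudeMourreDrudeDissolutionGradFluxGlue
import HarnessLib

/-!
# Preparations for the per-point sup bound: product sizes, the standard frame, the off-support case
(crux `EmbeddedDrudeMourre.DrudeDissolution`, item stmt-AtomisticToContinuum-12593; `--supports` file for the
registered sub-goal `flux_zero_of_eventuallyEq_zero` of stub B1b″ `stub_excursionSecondDifference` of line
`kinetic-polymer-gas-on-the-time-axis`; closes nothing; lead c13 (process B), 2026-08-17)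

WHAT.
* `product_g_bounds`: for `G = W·Θ` with `C²` factors, `0 ≤ Θ ≤ 1`, and pointwise sizes `|W| ≤ w₀`,
  `|∂W| ≤ w₁`, `|∂²W| ≤ w₂`, `|∂Θ| ≤ θ₁`, `|∂²Θ| ≤ θ₂` at `p` (two directions): `|G p| ≤ w₀`,
  `|∂G| ≤ w₁ + w₀θ₁`, `|∂ⱼ∂ᵢG| ≤ w₂ + 2w₁θ₁ + w₀θ₂`.
* `stdFrame_apply`, `stdFrame_admissible`: the frame `![(1,0,0),(0,1,0),(0,0,1)]`.
* `flux_zero_of_eventuallyEq_zero` (registered): if `G` vanishes identically near `p`, the double divergence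
  `∂₁(L_G X₁) + ∂₂(L_G X₂) + ∂₃(L_G X₃)` (`L_G = Σⱼ ∂ⱼ(G Xⱼ)`) vanishes at `p`, whatever the `Xⱼ`.

WHY (role). Item (C6) of the remaining concrete work for B1b″ (the sup hypothesis of
`cube_secondDiff_of_cutoffFamily`): sizes of `G = WΘ_η` and the off-support case.
-/

noncomputable section

open scoped Topology
open Filter Set

namespace Summit.AtomisticToContinuum.FouriersLaw.Theorems.DrudeDissolution.KineticPolymerGasOnTheTimeAxis

/-! ### Sizes of `G = W·Θ` -/

/-- **Product sizes.** See the module docstring. [folklore] -/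
theorem product_g_bounds {V : Type*} [NormedAddCommGroup V] [NormedSpace ℝ V] {W Θ : V → ℝ}
    (hW : ContDiff ℝ 2 W) (hΘ : ContDiff ℝ 2 Θ) (hΘ01 : ∀ q, 0 ≤ Θ q ∧ Θ q ≤ 1) (p u v : V)
    {w₀ w₁ w₂ θ₁ θ₂ : ℝ} (b0 : |W p| ≤ w₀) (bu : |fderiv ℝ W p u| ≤ w₁) (bv : |fderiv ℝ W p v| ≤ w₁)
    (buv : |fderiv ℝ (fun q => fderiv ℝ W q u) p v| ≤ w₂) (tu : |fderiv ℝ Θ p u| ≤ θ₁) (tv : |fderiv ℝ Θ p v| ≤ θ₁)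
    (tuv : |fderiv ℝ (fun q => fderiv ℝ Θ q u) p v| ≤ θ₂) :
    |W p * Θ p| ≤ w₀ ∧ |fderiv ℝ (fun q => W q * Θ q) p u| ≤ w₁ + w₀ * θ₁ ∧
      |fderiv ℝ (fun q => fderiv ℝ (fun r => W r * Θ r) q u) p v| ≤ w₂ + 2 * w₁ * θ₁ + w₀ * θ₂ := by
  have hWd : Differentiable ℝ W := hW.differentiable (by norm_num)
  have hΘd : Differentiable ℝ Θ := hΘ.differentiable (by norm_num)
  have hw₀ : 0 ≤ w₀ := (abs_nonneg _).trans b0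
  have hw₁ : 0 ≤ w₁ := (abs_nonneg _).trans bu
  have hθ₁ : 0 ≤ θ₁ := (abs_nonneg _).trans tu
  have aΘ : |Θ p| ≤ 1 := by rw [abs_of_nonneg (hΘ01 p).1]; exact (hΘ01 p).2
  refine ⟨?_, ?_, ?_⟩
  · rw [abs_mul]; exact (mul_le_mul b0 aΘ (abs_nonneg _) hw₀).trans (by rw [mul_one])
  · rw [fp_mul (hWd p) (hΘd p)]
    calc |fderiv ℝ W p u * Θ p + W p * fderiv ℝ Θ p u|
        ≤ |fderiv ℝ W p u * Θ p| + |W p * fderiv ℝ Θ p u| := abs_add_le _ _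
      _ = |fderiv ℝ W p u| * |Θ p| + |W p| * |fderiv ℝ Θ p u| := by rw [abs_mul, abs_mul]
      _ ≤ w₁ * 1 + w₀ * θ₁ := add_le_add (mul_le_mul bu aΘ (abs_nonneg _) hw₁) (mul_le_mul b0 tu (abs_nonneg _) hw₀)
      _ = w₁ + w₀ * θ₁ := by ring
  · rw [fp_mul2 hW hΘ p u v]
    have t1 : |fderiv ℝ (fun q => fderiv ℝ W q u) p v * Θ p| ≤ w₂ := by
      rw [abs_mul]; exact (mul_le_mul buv aΘ (abs_nonneg _) ((abs_nonneg _).trans buv)).trans (by rw [mul_one])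
    have t2 : |fderiv ℝ W p u * fderiv ℝ Θ p v| ≤ w₁ * θ₁ := by
      rw [abs_mul]; exact mul_le_mul bu tv (abs_nonneg _) hw₁
    have t3 : |fderiv ℝ W p v * fderiv ℝ Θ p u| ≤ w₁ * θ₁ := by
      rw [abs_mul]; exact mul_le_mul bv tu (abs_nonneg _) hw₁
    have t4 : |W p * fderiv ℝ (fun q => fderiv ℝ Θ q u) p v| ≤ w₀ * θ₂ := by
      rw [abs_mul]; exact mul_le_mul b0 tuv (abs_nonneg _) hw₀
    calc _ ≤ |fderiv ℝ (fun q => fderiv ℝ W q u) p v * Θ p| + |fderiv ℝ W p u * fderiv ℝ Θ p v| +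
          |fderiv ℝ W p v * fderiv ℝ Θ p u| + |W p * fderiv ℝ (fun q => fderiv ℝ Θ q u) p v| := by
          refine (abs_add_le _ _).trans (add_le_add ((abs_add_le _ _).trans (add_le_add (abs_add_le _ _) le_rfl)) le_rfl)
      _ ≤ w₂ + w₁ * θ₁ + w₁ * θ₁ + w₀ * θ₂ := by linarith
      _ = w₂ + 2 * w₁ * θ₁ + w₀ * θ₂ := by ring

/-! ### The standard frame -/

/-- The values of the standard frame. [folklore] -/
theorem stdFrame_apply :
    (![((1 : ℝ), (0 : ℝ), (0 : ℝ)), (0, 1, 0), (0, 0, 1)] : Fin 3 → ℝ × ℝ × ℝ) 0 = (1, 0, 0) ∧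
      (![((1 : ℝ), (0 : ℝ), (0 : ℝ)), (0, 1, 0), (0, 0, 1)] : Fin 3 → ℝ × ℝ × ℝ) 1 = (0, 1, 0) ∧
      (![((1 : ℝ), (0 : ℝ), (0 : ℝ)), (0, 1, 0), (0, 0, 1)] : Fin 3 → ℝ × ℝ × ℝ) 2 = (0, 0, 1) :=
  ⟨rfl, rfl, rfl⟩

/-- The standard frame is admissible: coordinates and the two half-differences are bounded by `1`. [folklore] -/
theorem stdFrame_admissible (i : Fin 3) :
    |((![((1 : ℝ), (0 : ℝ), (0 : ℝ)), (0, 1, 0), (0, 0, 1)] : Fin 3 → ℝ × ℝ × ℝ) i).1| ≤ 1 ∧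
      |((![((1 : ℝ), (0 : ℝ), (0 : ℝ)), (0, 1, 0), (0, 0, 1)] : Fin 3 → ℝ × ℝ × ℝ) i).2.1| ≤ 1 ∧
      |((![((1 : ℝ), (0 : ℝ), (0 : ℝ)), (0, 1, 0), (0, 0, 1)] : Fin 3 → ℝ × ℝ × ℝ) i).2.2| ≤ 1 ∧
      |((![((1 : ℝ), (0 : ℝ), (0 : ℝ)), (0, 1, 0), (0, 0, 1)] : Fin 3 → ℝ × ℝ × ℝ) i).2.1 -
          ((![((1 : ℝ), (0 : ℝ), (0 : ℝ)), (0, 1, 0), (0, 0, 1)] : Fin 3 → ℝ × ℝ × ℝ) i).1| ≤ 1 ∧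
      |((![((1 : ℝ), (0 : ℝ), (0 : ℝ)), (0, 1, 0), (0, 0, 1)] : Fin 3 → ℝ × ℝ × ℝ) i).2.1 -
          ((![((1 : ℝ), (0 : ℝ), (0 : ℝ)), (0, 1, 0), (0, 0, 1)] : Fin 3 → ℝ × ℝ × ℝ) i).2.2| ≤ 1 := by
  fin_cases i <;> simp

/-! ### The off-support case -/

/-- **Registered sub-goal `flux_zero_of_eventuallyEq_zero` of stub B1b″: the double divergence vanishes where `G`
vanishes identically.** For any `G, X₁, X₂, X₃` and `p` with `G = 0` near `p`, and `L` the divergence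
`L q = ∂₁(G X₁)(q) + ∂₂(G X₂)(q) + ∂₃(G X₃)(q)`:
`∂₁(L X₁)(p) + ∂₂(L X₂)(p) + ∂₃(L X₃)(p) = 0`. [folklore] -/
theorem flux_zero_of_eventuallyEq_zero :
    ∀ (G X₁ X₂ X₃ L : ℝ × ℝ × ℝ → ℝ) (p : ℝ × ℝ × ℝ), G =ᶠ[𝓝 p] 0 →
      (∀ q, L q = fderiv ℝ (fun r => G r * X₁ r) q (1, 0, 0) + fderiv ℝ (fun r => G r * X₂ r) q (0, 1, 0) +
        fderiv ℝ (fun r => G r * X₃ r) q (0, 0, 1)) →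
      fderiv ℝ (fun q => L q * X₁ q) p (1, 0, 0) + fderiv ℝ (fun q => L q * X₂ q) p (0, 1, 0) +
        fderiv ℝ (fun q => L q * X₃ q) p (0, 0, 1) = 0 := by
  intro G X₁ X₂ X₃ L p hG hL
  -- `G Xⱼ` vanish near `p`, hence so do their partials, hence `L`, hence `L Xⱼ`
  have hGX : ∀ X : ℝ × ℝ × ℝ → ℝ, (fun r => G r * X r) =ᶠ[𝓝 p] 0 := fun X =>
    hG.mono fun q hq => by simp only [Pi.zero_apply] at hq ⊢; rw [hq, zero_mul]
  have h1 := fderiv_eventuallyEq_zero (hGX X₁) (1, 0, 0)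
  have h2 := fderiv_eventuallyEq_zero (hGX X₂) (0, 1, 0)
  have h3 := fderiv_eventuallyEq_zero (hGX X₃) (0, 0, 1)
  have hL0 : L =ᶠ[𝓝 p] 0 := by
    filter_upwards [h1, h2, h3] with q a1 a2 a3
    simp only [Pi.zero_apply] at a1 a2 a3 ⊢
    rw [hL, a1, a2, a3, add_zero, add_zero]
  have hLX : ∀ X : ℝ × ℝ × ℝ → ℝ, (fun q => L q * X q) =ᶠ[𝓝 p] 0 := fun X =>
    hL0.mono fun q hq => by simp only [Pi.zero_apply] at hq ⊢; rw [hq, zero_mul]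
  have hz : ∀ (X : ℝ × ℝ × ℝ → ℝ) (v : ℝ × ℝ × ℝ), fderiv ℝ (fun q => L q * X q) p v = 0 := fun X v => by
    rw [(hLX X).fderiv_eq]; simp
  rw [hz, hz, hz, add_zero, add_zero]

end Summit.AtomisticToContinuum.FouriersLaw.Theorems.DrudeDissolution.KineticPolymerGasOnTheTimeAxis

end
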